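/-
Copyright (c) 2026 the pub-hodgecm-mathlib formalisation cell (harness21).  Prover seat hodgecm-mathlib-K2E4-p10 (g8), Track B «K2-LIT»,
#184♮ = hLiu418 = `stmt-HodgeConjecture-24832`; ROAD Φ of socket #41, TOP EDITION-3 FEEDER (LEAD F0P6-plan (g14) BATCH #47 (2) 2026-09-04T15:23:16Z; desk K2E5-p17 (g8);
books K2E5-plan (g7)): the WHITTAKER-KIND (`det S ≠ 0`) per-`S` TERM PACKAGE in the 4-clause currency of ★ p861061 `exists_rankOne_package_cleared`.
THEOREMS ONLY (no `def`, no `instance`, no notation, no named-fact hypothesis, no `sorry`); hypothesis-first, abstract `X`.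
-/
import Summits.HodgeConjecture.HodgeConjecture.Theorems.K2LiuContinuityFromHalfPlane          -- ★ Vitali `continuous_of_differentiableOn_halfPlane` (clause (ii), gift (A-4))
import Summits.HodgeConjecture.HodgeConjecture.Theorems.K2LiuSiegelUnipotentHaarPinned         -- ★ Φ3b `locallyCompactSpace_unipDelta` (§3: a Fourier carrier exists)
import Summits.HodgeConjecture.HodgeConjecture.Theorems.K2LiuUnipotentCocompact               -- ★ (C0) `exists_isCompact_cover_unipDelta`
import Summits.HodgeConjecture.HodgeConjecture.Theorems.K2LiuUnipotentCoveringWeight          -- ★ `exists_isCoveringWeight_unipDeltaRat_lintegral_ne_top`, `countable_unipDeltaRat`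
import Summits.HodgeConjecture.HodgeConjecture.Theorems.K2LiuUnipDeltaConjMeasurePreserving   -- ★ `lintegral_ne_zero_of_isCoveringWeight`
import Literature.NumberTheory.K2Lit.SiegelEisensteinSeriesDoubled                           -- ★ `eisensteinFamilyDelta`
import Literature.NumberTheory.Automorphic.AdelicHeightGLContinuity                          -- ★ `continuous_adelicHeightGL`
import Literature.NumberTheory.Automorphic.AdelicHeightGLProofs                              -- ★ `adelicHeightGL_pos_holds`
import Mathlib.Analysis.SpecialFunctions.Pow.Real
import Mathlib.Analysis.Calculus.Deriv.Mul
import HarnessLib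

/-!
# Crux `HLiu418`, ROAD Φ of socket #41 — `K2LiuSiegelEisensteinWhittakerTermPackage`: THE WHITTAKER-KIND TERM PACKAGE (`det S ≠ 0`) OF A SIEGEL EISENSTEIN FOURIER COEFFICIENT,
# hypothesis-first over the Euler factorisation (rows G1–G4 of the Φ9 consumer sheet BY VALUE), in the 4-clause currency (i)(ii)(iv)(v) of ★ p861061

Cell `hodgecm-mathlib`, crux item hLiu418 = `stmt-HodgeConjecture-24832` (helper lane `--supports … --as helper`, count-neutral), route of record `HCCMUnconditional`; squad K2 ∕ K2Liu,
road `K2_Liu`, socket #41 `sig_K2LiuSiegelEisensteinContinuation`; consumer = the TOP ★ p861283∕p861313 `K2LiuSiegelEisensteinContinuationTop` edition 3 (three-kind split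
`Ec S := if S = 0 then Ec0 else if det ↑S = 0 then Ec1 S else EcW S`), which instantiates this file at `X := H(𝔸)`, `RK s h := (E^Δ(·; f_s))_S(h) = fourierCoeffDelta … ↑S (E^Δ f s) h`
for each lattice index `S` with `det S ≠ 0`.
THE MATHEMATICS ([KudlaRallis1994, §1]; [Tan1999, §2–§3, §4 Prop. 4.8]; [Shimura1997, §18.3–18.5]; [MoeglinWaldspurger1995, IV.1.9–IV.1.11]).  For a non-degenerate index `S` the `S`-th
Fourier coefficient of the Siegel Eisenstein series is, on the half-plane of absolute convergence `{c < re s}`, an EULER PRODUCT (row G1, ★ `K2LiuWhittakerDeltaEulerProduct.whittakerDelta_eq_mul_tprod_euler`):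
`W_S(f_s)(h) = W_{S,T}(s)(h) · ∏'_{v∉T} W°_{S,v}(s)(h_v)`, `T ⊇ T₀(𝒦, f, h_f, S)` a finite set of places containing the archimedean and the bad ones; the restricted product over the good places is
(row G2, ★ `K2LiuGoodPlaceWhittakerEulerAssembly.tprod_whittaker_face_eq` + the per-place glue `K2LiuGoodPlaceLocalFactor`) `(b^{D(S)∪T}(s))⁻¹ · ∏_{v∈D(S)∖T} W°_{S,v}(s)∕m_v`,
`b^U(s) = ζ^U_{L⁺}(2s+1)·L^U(2s+2, ε_{L∕L⁺})`, HOLOMORPHIC on `{0 < re s}` (★ `differentiableOn_face_cm`); the finitely many bad finite factors are ENTIRE in `s` (row G3, ★ Φ5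
`K2LiuBadPlaceWhittaker*`, ★ p861180∕p861217) and the archimedean ones holomorphic (row G4, ★ Φ6b-5).  HENCE `W_S(f_s)(h)` CONTINUES to `{0 < re s}` as the product of its factors, with
NO pole: the Whittaker-kind package is `E_S(s,h) := (∏_{p∈P}(s − p)) · (∏_k W_k(s,h)) · G(s,h)` for ANY pole set `P` (the TOP's common `P` comes from the degenerate kinds), and its four
clauses are: (i) holomorphy on `{0 < re}` — products of holomorphic functions; (iv) `E_S = (∏(s−p))·W_S` on `{c < re}` — the Euler identity; (v) locally uniform moderate growth — from the
growth letters of the factors (this file multiplies them: exponents ADD, `H^{A₁}·H^{A₂} = H^{A₁+A₂}`); (ii) continuity in `h` for `0 < re s` — ★ Vitali `continuous_of_differentiableOn_halfPlane`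
from (i), (v), the compact bound of the height and the continuity of `W_S(f_s)` in `h` on the convergence half-plane (gift (A-4) of the consumer sheet).  Everything here is hypothesis-first over
an ABSTRACT space `X` (pattern and currency of ★ p861061): the factors, their holomorphy and growth, and the Euler identity enter BY VALUE; the payers are rows G1–G4.
* §1 growth algebra in the clause-(v) currency: `growth_mul`, `growth_finsetProd`, `growth_poly_mul`; holomorphy `differentiableOn_poly_mul_finsetProd_mul`.
* §2 the EXPLICIT package `E s x := (∏_{p∈P}(s − p))·(WT s x·G s x)`: `differentiableOn_whittakerPackage`, `growth_whittakerPackage`, `continuous_whittakerPackage` (Vitali); then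
  **`exists_whittaker_package`** (one bad×arch factor `WT`, one good-place factor `G`, growth of the product BY VALUE) and **`exists_whittaker_package_of_factors`** (a finite family of
  local factors `W k`, `k ∈ κ`, and `G`, with PER-FACTOR growth letters) — OUTPUT the four clauses (i)(ii)(iv)(v) verbatim in ★ p861061's shape with a general pole set `P`.
* §3 **`exists_whittaker_packages_fourierCoeff`** — THE INSTANCE AT `X := H(𝔸)` (desk K2E5-p17 (g8) 15:26:16Z): height `‖h‖ = adelicHeightGL (n+n) L ↑h` (positivity ★ `adelicHeightGL_pos_holds`,
  compact bound by ★ `continuous_adelicHeightGL`), the factors `WT S`, `G S` INDEXED BY THE LATTICE `skewMatrices`, growth with an EXPLICIT by-value weight `w S` (`‖WT·G‖ ≤ C(z)·w(S)·‖h‖^A`, for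
  the lattice majorant assembler), the Euler identity and the coefficient's continuity CARRIER-GENERIC (`∀ νN [IsHaarMeasure] β, IsCoveringWeight → ∫β ≠ 0 → ∫β ≠ ∞ → …`, edition 2's `hcoef`
  shape; a carrier is built inside from ★ Φ3b ∕ ★ (C0) ∕ ★ covering weight, as edition 2 does) ⟹ `∃ EcW : skewMatrices → ℂ → H(𝔸) → ℂ` with EXACTLY the KIND-W binders of edition 3:
  `hWoff` (`EcW S = 0` when `det S = 0`), `hWd`, `hWc`, `hWcoef` (carrier-generic, `det S ≠ 0`, `n∕2 < re s`), and the weighted growth `‖EcW S s h‖ ≤ C(z)·w(S)·‖h‖^A`.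
NOT HERE: the discharge of the letters (rows G1–G4) and the lattice-uniform majorant `hWmaj`∕`hWgr` (G4 × G7 assembler).
HONEST LABEL.  Count-neutral helper; `HC_CM` is proved only modulo the 7 printed citations (2 remaining named inputs: hLiu418 = `stmt-HodgeConjecture-24832`,
h413 = `stmt-HodgeConjecture-24833`) until rung 0 closes.

## References
* [KudlaRallis1994] S. Kudla, S. Rallis, *A regularized Siegel–Weil formula: the first term identity*, Ann. of Math. 140 (1994), §1.
* [Tan1999] V. Tan, *Poles of Siegel Eisenstein series on U(n,n)*, Canad. J. Math. 51 (1999), §2–§3, §4 Prop. 4.8.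
* [Shimura1997] G. Shimura, *Euler Products and Eisenstein Series*, CBMS 93 (1997), §18.3–18.5.
* [MoeglinWaldspurger1995] C. Mœglin, J.-L. Waldspurger, *Spectral decomposition and Eisenstein series* (1995), IV.1.9–IV.1.11.
-/

set_option autoImplicit false
set_option linter.dupNamespace false -- the mandated namespace repeats `HodgeConjecture.HodgeConjecture`

noncomputable section

namespace Summit.HodgeConjecture.HodgeConjecture.Cruxes.HLiu418.K2LiuSiegelEisensteinWhittakerTermPackage

open Set Filter Topology Metric Complex
open scoped BigOperators
open K2LiuContinuityFromHalfPlane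

variable {X : Type*}

/-! ## §1 Growth algebra in the clause-(v) currency; holomorphy of the product -/

section Growth

variable (height : X → ℝ)

/-- **growth of a PRODUCT**: if `F₁`, `F₂` satisfy the (signed) clause-(v) growth letter `‖F_i(s,x)‖ ≤ C_i·H(x)^{A_i}` near every `z` with `0 < re z` (uniformly in `x`) and `H > 0`, then so
does `F₁·F₂`, with exponent `A₁ + A₂` (`H^{A₁}·H^{A₂} = H^{A₁+A₂}`). [cite: MoeglinWaldspurger1995, IV.1.9] -/
theorem growth_mul (hpos : ∀ x, 0 < height x) {F₁ F₂ : ℂ → X → ℂ}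
    (h₁ : ∀ z : ℂ, 0 < z.re → ∃ C A r : ℝ, 0 ≤ C ∧ 0 ≤ A ∧ 0 < r ∧ ∀ s : ℂ, dist s z < r → ∀ x, ‖F₁ s x‖ ≤ C * height x ^ A)
    (h₂ : ∀ z : ℂ, 0 < z.re → ∃ C A r : ℝ, 0 ≤ C ∧ 0 ≤ A ∧ 0 < r ∧ ∀ s : ℂ, dist s z < r → ∀ x, ‖F₂ s x‖ ≤ C * height x ^ A) :
    ∀ z : ℂ, 0 < z.re → ∃ C A r : ℝ, 0 ≤ C ∧ 0 ≤ A ∧ 0 < r ∧ ∀ s : ℂ, dist s z < r → ∀ x, ‖F₁ s x * F₂ s x‖ ≤ C * height x ^ A := by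
  intro z hz
  obtain ⟨C₁, A₁, r₁, hC₁, hA₁, hr₁, hle₁⟩ := h₁ z hz
  obtain ⟨C₂, A₂, r₂, hC₂, hA₂, hr₂, hle₂⟩ := h₂ z hz
  refine ⟨C₁ * C₂, A₁ + A₂, min r₁ r₂, by positivity, by positivity, lt_min hr₁ hr₂, fun s hs x => ?_⟩
  have hx := hpos x
  calc ‖F₁ s x * F₂ s x‖ = ‖F₁ s x‖ * ‖F₂ s x‖ := norm_mul _ _
    _ ≤ (C₁ * height x ^ A₁) * (C₂ * height x ^ A₂) :=
        mul_le_mul (hle₁ s (lt_of_lt_of_le hs (min_le_left _ _)) x) (hle₂ s (lt_of_lt_of_le hs (min_le_right _ _)) x) (norm_nonneg _)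
          (mul_nonneg hC₁ (Real.rpow_nonneg hx.le _))
    _ = C₁ * C₂ * (height x ^ A₁ * height x ^ A₂) := by ring
    _ = C₁ * C₂ * height x ^ (A₁ + A₂) := by rw [← Real.rpow_add hx]

/-- the constant function `1` satisfies the clause-(v) growth letter (`C = 1`, `A = 0`). [folklore] -/
theorem growth_one :
    ∀ z : ℂ, 0 < z.re → ∃ C A r : ℝ, 0 ≤ C ∧ 0 ≤ A ∧ 0 < r ∧ ∀ s : ℂ, dist s z < r → ∀ x, ‖(fun (_ : ℂ) (_ : X) => (1 : ℂ)) s x‖ ≤ C * height x ^ A :=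
  fun _ _ => ⟨1, 0, 1, zero_le_one, le_rfl, one_pos, fun _ _ x => by rw [norm_one, Real.rpow_zero, mul_one]⟩

/-- **growth of a FINITE PRODUCT of factors**: per-factor clause-(v) letters ⟹ the letter for `∏_{k∈K} W_k`. [cite: MoeglinWaldspurger1995, IV.1.9] [cite: Tan1999, §3] -/
theorem growth_finsetProd (hpos : ∀ x, 0 < height x) {κ : Type*} (W : κ → ℂ → X → ℂ) (K : Finset κ)
    (hW : ∀ k ∈ K, ∀ z : ℂ, 0 < z.re → ∃ C A r : ℝ, 0 ≤ C ∧ 0 ≤ A ∧ 0 < r ∧ ∀ s : ℂ, dist s z < r → ∀ x, ‖W k s x‖ ≤ C * height x ^ A) :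
    ∀ z : ℂ, 0 < z.re → ∃ C A r : ℝ, 0 ≤ C ∧ 0 ≤ A ∧ 0 < r ∧ ∀ s : ℂ, dist s z < r → ∀ x, ‖∏ k ∈ K, W k s x‖ ≤ C * height x ^ A := by
  classical
  induction K using Finset.induction_on with
  | empty => simpa only [Finset.prod_empty] using growth_one height
  | insert k K hk ih =>
    have hk' := hW k (Finset.mem_insert_self k K)
    have hK' := ih fun k' hk'' => hW k' (Finset.mem_insert_of_mem hk'')
    simpa only [Finset.prod_insert hk] using growth_mul height hpos hk' hK'

/-- **growth of `a(s)·F(s,x)` for a CONTINUOUS scalar `a`** (e.g. the pole-clearing polynomial `∏_{p∈P}(s − p)`): near `z` the scalar is bounded by `‖a z‖ + 1`. [folklore] -/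
theorem growth_scalar_mul {a : ℂ → ℂ} (ha : Continuous a) {F : ℂ → X → ℂ}
    (hF : ∀ z : ℂ, 0 < z.re → ∃ C A r : ℝ, 0 ≤ C ∧ 0 ≤ A ∧ 0 < r ∧ ∀ s : ℂ, dist s z < r → ∀ x, ‖F s x‖ ≤ C * height x ^ A) :
    ∀ z : ℂ, 0 < z.re → ∃ C A r : ℝ, 0 ≤ C ∧ 0 ≤ A ∧ 0 < r ∧ ∀ s : ℂ, dist s z < r → ∀ x, ‖a s * F s x‖ ≤ C * height x ^ A := by
  intro z hz
  obtain ⟨C, A, r, hC, hA, hr, hle⟩ := hF z hz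
  obtain ⟨δ, hδ, hd⟩ := Metric.continuousAt_iff.1 ha.continuousAt 1 one_pos
  refine ⟨(‖a z‖ + 1) * C, A, min r δ, by positivity, hA, lt_min hr hδ, fun s hs x => ?_⟩
  have ha' : ‖a s‖ ≤ ‖a z‖ + 1 := by
    have h1 : dist (a s) (a z) < 1 := hd (lt_of_lt_of_le hs (min_le_right _ _))
    rw [dist_eq_norm] at h1
    calc ‖a s‖ = ‖a z + (a s - a z)‖ := by rw [add_sub_cancel]
      _ ≤ ‖a z‖ + ‖a s - a z‖ := norm_add_le _ _
      _ ≤ ‖a z‖ + 1 := by linarith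
  calc ‖a s * F s x‖ = ‖a s‖ * ‖F s x‖ := norm_mul _ _
    _ ≤ (‖a z‖ + 1) * (C * height x ^ A) := mul_le_mul ha' (hle s (lt_of_lt_of_le hs (min_le_left _ _)) x) (norm_nonneg _) (by positivity)
    _ = (‖a z‖ + 1) * C * height x ^ A := by ring

/-- the pole-clearing polynomial `s ↦ ∏_{p∈P}(s − p)` is continuous (indeed entire). [folklore] -/
theorem continuous_poleClearing (P : Finset ℂ) : Continuous fun s : ℂ => ∏ p ∈ P, (s - p) :=
  continuous_finsetProd _ fun _ _ => continuous_id.sub continuous_const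

/-- the pole-clearing polynomial is entire. [folklore] -/
theorem differentiable_poleClearing (P : Finset ℂ) : Differentiable ℂ fun s : ℂ => ∏ p ∈ P, (s - p) :=
  Differentiable.fun_finsetProd fun _ _ => differentiable_id.sub_const _

end Growth

/-! ## §2 The Whittaker-kind term package `E s x := (∏_{p∈P}(s − p))·(WT s x·G s x)` -/

section Package

variable [TopologicalSpace X]

omit [TopologicalSpace X] in
/-- (i) **holomorphy** of `s ↦ (∏_{p∈P}(s − p))·(WT s x·G s x)` on `{0 < re}` from that of the factors. [cite: KudlaRallis1994, §1] [cite: Tan1999, §3] -/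
theorem differentiableOn_whittakerPackage (WT G : ℂ → X → ℂ) (hWTd : ∀ x, DifferentiableOn ℂ (fun s => WT s x) {s : ℂ | 0 < s.re})
    (hGd : ∀ x, DifferentiableOn ℂ (fun s => G s x) {s : ℂ | 0 < s.re}) (P : Finset ℂ) (x : X) :
    DifferentiableOn ℂ (fun s => (∏ p ∈ P, (s - p)) * (WT s x * G s x)) {s : ℂ | 0 < s.re} :=
  (differentiable_poleClearing P).differentiableOn.mul ((hWTd x).mul (hGd x))

omit [TopologicalSpace X] in
/-- (v) **growth** (signed) of the package from the growth letter of `WT·G`. [cite: MoeglinWaldspurger1995, IV.1.9] [cite: Tan1999, §4 Prop. 4.8] -/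
theorem growth_whittakerPackage (height : X → ℝ) (WT G : ℂ → X → ℂ)
    (hg : ∀ z : ℂ, 0 < z.re → ∃ C A r : ℝ, 0 ≤ C ∧ 0 ≤ A ∧ 0 < r ∧ ∀ s : ℂ, dist s z < r → ∀ x, ‖WT s x * G s x‖ ≤ C * height x ^ A) (P : Finset ℂ) :
    ∀ z : ℂ, 0 < z.re → ∃ C A r : ℝ, 0 ≤ C ∧ 0 ≤ A ∧ 0 < r ∧ ∀ s : ℂ, dist s z < r → ∀ x, ‖(∏ p ∈ P, (s - p)) * (WT s x * G s x)‖ ≤ C * height x ^ A :=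
  growth_scalar_mul height (continuous_poleClearing P) hg

variable [FirstCountableTopology X]

/-- (ii) **continuity in `x`** of the package for `0 < re s` — ★ Vitali `continuous_of_differentiableOn_halfPlane` from (i), (v), the compact bound of the height, and the continuity of the
coefficient `RK s = WT s·G s` on the convergence half-plane `{c < re}`. [cite: MoeglinWaldspurger1995, IV.1.11] [cite: Tan1999, §4 Prop. 4.8] -/
theorem continuous_whittakerPackage
    (height : X → ℝ) (hpos : ∀ x, 0 < height x) (hcpt : ∀ K : Set X, IsCompact K → ∃ B : ℝ, ∀ x ∈ K, height x ≤ B)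
    (WT : ℂ → X → ℂ) (hWTd : ∀ x, DifferentiableOn ℂ (fun s => WT s x) {s : ℂ | 0 < s.re})
    (G : ℂ → X → ℂ) (hGd : ∀ x, DifferentiableOn ℂ (fun s => G s x) {s : ℂ | 0 < s.re})
    (hg : ∀ z : ℂ, 0 < z.re → ∃ C A r : ℝ, 0 ≤ C ∧ 0 ≤ A ∧ 0 < r ∧ ∀ s : ℂ, dist s z < r → ∀ x, ‖WT s x * G s x‖ ≤ C * height x ^ A)
    {c : ℝ} (hc : 0 ≤ c) (RK : ℂ → X → ℂ) (hRKc : ∀ s : ℂ, c < s.re → Continuous (RK s))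
    (hRK : ∀ (s : ℂ) (x : X), c < s.re → RK s x = WT s x * G s x) (P : Finset ℂ) {s : ℂ} (hs : 0 < s.re) :
    Continuous fun x => (∏ p ∈ P, (s - p)) * (WT s x * G s x) := by
  refine continuous_of_differentiableOn_halfPlane (a := 0) (c := c) hc (fun s x => (∏ p ∈ P, (s - p)) * (WT s x * G s x))
    (differentiableOn_whittakerPackage WT G hWTd hGd P) (fun K hK z hz => ?_) (fun s' hs' => ?_) hs
  · obtain ⟨C, A, r, hC, hA, hr, hle⟩ := growth_whittakerPackage height WT G hg P z hz
    obtain ⟨B, hB⟩ := hcpt K hK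
    refine ⟨C * max B 1 ^ A, r, hr, fun s' hs' x hx => (hle s' (mem_ball.1 hs') x).trans ?_⟩
    exact mul_le_mul_of_nonneg_left (Real.rpow_le_rpow (hpos x).le ((hB x hx).trans (le_max_left _ _)) hA) hC
  · have h : Continuous fun x => (∏ p ∈ P, (s' - p)) * RK s' x := continuous_const.mul (hRKc s' hs')
    exact h.congr fun x => by rw [hRK s' x hs']

/-- **THE WHITTAKER-KIND TERM PACKAGE (`det S ≠ 0`), ONE bad×archimedean factor.**  DATA (by value, `S` fixed, `X` abstract — read `X = H(𝔸)`): a height (positive, bounded on compacts);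
the BAD-PLACE × ARCHIMEDEAN Whittaker factor `WT s x = W_{S,T}(s)(x)` (rows G3 × G4), holomorphic on `{0 < re}` in `s`; the GOOD-PLACE Euler factor `G s x = (b^{D(S)∪T}(s))⁻¹·∏_{v∈D(S)∖T}
W°_{S,v}(s)(x_v)∕m_v` (row G2), holomorphic on `{0 < re}`; the clause-(v) growth letter for the product `WT·G`; and the coefficient `RK s x = W_S(f_s)(x)`, continuous in `x` and EQUAL to
`WT s x · G s x` on the convergence half-plane `{c < re}` (row G1's Euler product + row G2's face).  THEN, for every pole set `P`, `E s x := (∏_{p∈P}(s − p))·(WT s x·G s x)` satisfies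
(i) `s ↦ E s x` holomorphic on `{0 < re}`, (ii) `E s` continuous for `0 < re s` (★ Vitali), (iv) `E s x = (∏_{p∈P}(s − p))·RK s x` on `{c < re}`, (v) locally uniform moderate growth — the
four clauses of ★ p861061, with a general `P`. [cite: KudlaRallis1994, §1] [cite: Tan1999, §4 Prop. 4.8] [cite: Shimura1997, §18.4] [cite: MoeglinWaldspurger1995, IV.1.9–IV.1.11] -/
theorem exists_whittaker_package
    (height : X → ℝ) (hpos : ∀ x, 0 < height x) (hcpt : ∀ K : Set X, IsCompact K → ∃ B : ℝ, ∀ x ∈ K, height x ≤ B)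
    (WT : ℂ → X → ℂ) (hWTd : ∀ x, DifferentiableOn ℂ (fun s => WT s x) {s : ℂ | 0 < s.re})
    (G : ℂ → X → ℂ) (hGd : ∀ x, DifferentiableOn ℂ (fun s => G s x) {s : ℂ | 0 < s.re})
    (hg : ∀ z : ℂ, 0 < z.re → ∃ C A r : ℝ, 0 ≤ C ∧ 0 ≤ A ∧ 0 < r ∧ ∀ s : ℂ, dist s z < r → ∀ x, ‖WT s x * G s x‖ ≤ C * height x ^ A)
    {c : ℝ} (hc : 0 ≤ c) (RK : ℂ → X → ℂ) (hRKc : ∀ s : ℂ, c < s.re → Continuous (RK s))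
    (hRK : ∀ (s : ℂ) (x : X), c < s.re → RK s x = WT s x * G s x) (P : Finset ℂ) :
    ∃ E : ℂ → X → ℂ,
      (∀ x, DifferentiableOn ℂ (fun s => E s x) {s : ℂ | 0 < s.re}) ∧
      (∀ s : ℂ, 0 < s.re → Continuous (E s)) ∧
      (∀ (s : ℂ) (x : X), c < s.re → E s x = (∏ p ∈ P, (s - p)) * RK s x) ∧
      (∀ z : ℂ, 0 < z.re → ∃ C A r : ℝ, 0 < r ∧ ∀ s : ℂ, dist s z < r → ∀ x, ‖E s x‖ ≤ C * height x ^ A) :=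
  ⟨fun s x => (∏ p ∈ P, (s - p)) * (WT s x * G s x), differentiableOn_whittakerPackage WT G hWTd hGd P,
    fun _ hs => continuous_whittakerPackage height hpos hcpt WT hWTd G hGd hg hc RK hRKc hRK P hs,
    fun s x hs => by rw [hRK s x hs],
    fun z hz => by
      obtain ⟨C, A, r, _, _, hr, hle⟩ := growth_whittakerPackage height WT G hg P z hz
      exact ⟨C, A, r, hr, hle⟩⟩

/-- **THE WHITTAKER-KIND TERM PACKAGE, FINITELY MANY LOCAL FACTORS with PER-FACTOR letters.**  As `exists_whittaker_package`, but the bad×archimedean part is a PRODUCT `∏_{k∈K} W_k(s,x)` over a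
finite set `K` of places (rows G3: bad finite, ENTIRE in `s` with the (A-1) bound; G4: archimedean, holomorphic with decay), each factor holomorphic on `{0 < re}` with its own clause-(v)
letter, and the good-place factor `G` with its letter (row G2); the Euler identity `RK s x = (∏_{k∈K} W_k s x)·G s x` on `{c < re}` (rows G1 + G2).  OUTPUT: the four clauses for
`E s x := (∏_{p∈P}(s−p))·((∏_{k∈K} W_k s x)·G s x)`. [cite: KudlaRallis1994, §1] [cite: Tan1999, §2–§3, §4 Prop. 4.8] [cite: Shimura1997, §18.3–18.5] [cite: MoeglinWaldspurger1995, IV.1.9–IV.1.11] -/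
theorem exists_whittaker_package_of_factors
    (height : X → ℝ) (hpos : ∀ x, 0 < height x) (hcpt : ∀ K : Set X, IsCompact K → ∃ B : ℝ, ∀ x ∈ K, height x ≤ B)
    {κ : Type*} (K : Finset κ) (W : κ → ℂ → X → ℂ) (hWd : ∀ k ∈ K, ∀ x, DifferentiableOn ℂ (fun s => W k s x) {s : ℂ | 0 < s.re})
    (hWg : ∀ k ∈ K, ∀ z : ℂ, 0 < z.re → ∃ C A r : ℝ, 0 ≤ C ∧ 0 ≤ A ∧ 0 < r ∧ ∀ s : ℂ, dist s z < r → ∀ x, ‖W k s x‖ ≤ C * height x ^ A)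
    (G : ℂ → X → ℂ) (hGd : ∀ x, DifferentiableOn ℂ (fun s => G s x) {s : ℂ | 0 < s.re})
    (hGg : ∀ z : ℂ, 0 < z.re → ∃ C A r : ℝ, 0 ≤ C ∧ 0 ≤ A ∧ 0 < r ∧ ∀ s : ℂ, dist s z < r → ∀ x, ‖G s x‖ ≤ C * height x ^ A)
    {c : ℝ} (hc : 0 ≤ c) (RK : ℂ → X → ℂ) (hRKc : ∀ s : ℂ, c < s.re → Continuous (RK s))
    (hRK : ∀ (s : ℂ) (x : X), c < s.re → RK s x = (∏ k ∈ K, W k s x) * G s x) (P : Finset ℂ) :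
    ∃ E : ℂ → X → ℂ,
      (∀ x, DifferentiableOn ℂ (fun s => E s x) {s : ℂ | 0 < s.re}) ∧
      (∀ s : ℂ, 0 < s.re → Continuous (E s)) ∧
      (∀ (s : ℂ) (x : X), c < s.re → E s x = (∏ p ∈ P, (s - p)) * RK s x) ∧
      (∀ z : ℂ, 0 < z.re → ∃ C A r : ℝ, 0 < r ∧ ∀ s : ℂ, dist s z < r → ∀ x, ‖E s x‖ ≤ C * height x ^ A) :=
  exists_whittaker_package height hpos hcpt (fun s x => ∏ k ∈ K, W k s x)
    (fun x => DifferentiableOn.fun_finsetProd fun k hk => hWd k hk x) G hGd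
    (growth_mul height hpos (growth_finsetProd height hpos W K hWg) hGg) hc RK hRKc hRK P

end Package

/-! ## §3 The instance at `X := H(𝔸)`: lattice-indexed Whittaker packages of the Siegel Eisenstein Fourier coefficients, KIND-W binders of the TOP's edition 3 -/

section Instance

open scoped Matrix ENNReal NNReal
open NumberField IsDedekindDomain MeasureTheory
open Literature.NumberTheory.Automorphic Literature.NumberTheory.GelbartRogawski1991 Literature.NumberTheory.GelbartRogawski1991.GRConstruction
open Literature.NumberTheory.K2Lit.SiegelDoubled Literature.MeasureTheory.Group
open K2LiuSiegelUnipotentFourierDefs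
open K2LiuSiegelUnipotentHaarPinned (locallyCompactSpace_unipDelta)
open K2LiuUnipotentCocompact (exists_isCompact_cover_unipDelta)
open K2LiuUnipotentCoveringWeight (exists_isCoveringWeight_unipDeltaRat_lintegral_ne_top countable_unipDeltaRat)
open K2LiuUnipDeltaConjMeasurePreserving (lintegral_ne_zero_of_isCoveringWeight)

/-- **THE WHITTAKER-KIND PACKAGES AT `X := H(𝔸)` — the KIND-W binders of the TOP's edition 3.**  Frame `(L, e, dV, dW)` of the doubled hermitian space, `n ≥ 1`, a family of sections `f`.
DATA BY VALUE, indexed by the Fourier lattice `skewMatrices`: the bad×archimedean factors `WT S` and the good-place factors `G S` (rows G1–G4), holomorphic on `{0 < re}` in `s`; a weight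
`w S ≥ 0` and the WEIGHTED growth letter `‖WT S s h·G S s h‖ ≤ C(z)·w(S)·‖h‖^A` near every `z` (uniform in `S` and `h`; the `S`-dependence the assembler of the lattice majorant sums); and,
CARRIER-GENERICALLY (every Haar `νN` on `N_Δ(𝔸)` and covering weight `β` of finite non-zero mass, as edition 2's `hcoef`), the continuity of `h ↦ (E^Δ(·; f_s))_S(h)` and the EULER IDENTITY
`(E^Δ(·; f_s))_S(h) = WT S s h·G S s h` on `{n∕2 < re s}` for `det S ≠ 0`.  THEN there is `EcW : skewMatrices → ℂ → H(𝔸) → ℂ` — `EcW S s h := 0` if `det S = 0`, else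
`(∏_{p∈P}(s−p))·(WT S s h·G S s h)` — with: `hWoff` (`EcW S = 0` for `det S = 0`), `hWd` (holomorphic on `{0 < re}`), `hWc` (continuous in `h` for `0 < re s`, ★ Vitali at a carrier
built from ★ Φ3b∕(C0)∕covering weight), `hWcoef` (carrier-generic coefficient identity for `det S ≠ 0` on `{n∕2 < re}`), and the weighted growth `‖EcW S s h‖ ≤ C(z)·w(S)·‖h‖^A`.
[cite: KudlaRallis1994, §1] [cite: Tan1999, §1 Main Theorem, §4 Prop. 4.8] [cite: Shimura1997, §18.3–18.5] [cite: MoeglinWaldspurger1995, IV.1.8–IV.1.11] -/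
theorem exists_whittaker_packages_fourierCoeff
    (L : Type) [Field L] [NumberField L] [IsCMField L] {N M n : ℕ} (hn : 0 < n) (e : Fin N × Fin M ≃ Fin n)
    (dV : Fin N → L) (hdV : ∀ i, IsCMField.complexConj L (dV i) = dV i) (hdV0 : ∀ i, dV i ≠ 0)
    (dW : Fin M → L) (hdW : ∀ i, IsCMField.complexConj L (dW i) = dW i) (hdW0 : ∀ i, dW i ≠ 0)
    [MeasurableSpace (unipDelta L e dV hdV dW hdW)] [BorelSpace (unipDelta L e dV hdV dW hdW)]
    (f : ℂ → HA L e dV hdV dW hdW → ℂ)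
    (WT G : skewMatrices ((IsCMField.complexConj L : L ≃ₐ[Fp L] L) : L →+* L) ((gramR L e dV hdV dW hdW).map (algebraMap (Fp L) L)) → ℂ → HA L e dV hdV dW hdW → ℂ)
    (hWTd : ∀ S (h : HA L e dV hdV dW hdW), DifferentiableOn ℂ (fun s => WT S s h) {s : ℂ | 0 < s.re})
    (hGd : ∀ S (h : HA L e dV hdV dW hdW), DifferentiableOn ℂ (fun s => G S s h) {s : ℂ | 0 < s.re})
    (w : skewMatrices ((IsCMField.complexConj L : L ≃ₐ[Fp L] L) : L →+* L) ((gramR L e dV hdV dW hdW).map (algebraMap (Fp L) L)) → ℝ) (hw : ∀ S, 0 ≤ w S)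
    (hg : ∀ z : ℂ, 0 < z.re → ∃ C A r : ℝ, 0 ≤ C ∧ 0 ≤ A ∧ 0 < r ∧ ∀ S (s : ℂ), dist s z < r → ∀ h : HA L e dV hdV dW hdW,
      ‖WT S s h * G S s h‖ ≤ C * w S * adelicHeightGL (n + n) L (h : GL (Fin (n + n)) (AdeleRing (𝓞 L) L)) ^ A)
    (hRKc : ∀ (νN : Measure (unipDelta L e dV hdV dW hdW)) [νN.IsHaarMeasure] (β : unipDelta L e dV hdV dW hdW → ℝ≥0∞),
      IsCoveringWeight (unipDeltaRat L e dV hdV dW hdW) β → ∫⁻ u, β u ∂νN ≠ 0 → ∫⁻ u, β u ∂νN ≠ ∞ →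
      ∀ S : skewMatrices ((IsCMField.complexConj L : L ≃ₐ[Fp L] L) : L →+* L) ((gramR L e dV hdV dW hdW).map (algebraMap (Fp L) L)),
        (S : Matrix (Fin n) (Fin n) L).det ≠ 0 → ∀ s : ℂ, (n : ℝ) / 2 < s.re →
          Continuous fun h : HA L e dV hdV dW hdW =>
            fourierCoeffDelta L e dV hdV dW hdW νN β (S : Matrix (Fin n) (Fin n) L) (eisensteinFamilyDelta L e dV hdV dW hdW f s) h)
    (hRK : ∀ (νN : Measure (unipDelta L e dV hdV dW hdW)) [νN.IsHaarMeasure] (β : unipDelta L e dV hdV dW hdW → ℝ≥0∞),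
      IsCoveringWeight (unipDeltaRat L e dV hdV dW hdW) β → ∫⁻ u, β u ∂νN ≠ 0 → ∫⁻ u, β u ∂νN ≠ ∞ →
      ∀ S : skewMatrices ((IsCMField.complexConj L : L ≃ₐ[Fp L] L) : L →+* L) ((gramR L e dV hdV dW hdW).map (algebraMap (Fp L) L)),
        (S : Matrix (Fin n) (Fin n) L).det ≠ 0 → ∀ (s : ℂ) (h : HA L e dV hdV dW hdW), (n : ℝ) / 2 < s.re →
          fourierCoeffDelta L e dV hdV dW hdW νN β (S : Matrix (Fin n) (Fin n) L) (eisensteinFamilyDelta L e dV hdV dW hdW f s) h = WT S s h * G S s h)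
    (P : Finset ℂ) :
    ∃ EcW : skewMatrices ((IsCMField.complexConj L : L ≃ₐ[Fp L] L) : L →+* L) ((gramR L e dV hdV dW hdW).map (algebraMap (Fp L) L)) → ℂ → HA L e dV hdV dW hdW → ℂ,
      (∀ S : skewMatrices ((IsCMField.complexConj L : L ≃ₐ[Fp L] L) : L →+* L) ((gramR L e dV hdV dW hdW).map (algebraMap (Fp L) L)),
        (S : Matrix (Fin n) (Fin n) L).det = 0 → ∀ (s : ℂ) (h : HA L e dV hdV dW hdW), EcW S s h = 0) ∧
      (∀ S (h : HA L e dV hdV dW hdW), DifferentiableOn ℂ (fun s => EcW S s h) {s : ℂ | 0 < s.re}) ∧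
      (∀ S (s : ℂ), 0 < s.re → Continuous (EcW S s)) ∧
      (∀ (νN : Measure (unipDelta L e dV hdV dW hdW)) [νN.IsHaarMeasure] (β : unipDelta L e dV hdV dW hdW → ℝ≥0∞),
        IsCoveringWeight (unipDeltaRat L e dV hdV dW hdW) β → ∫⁻ u, β u ∂νN ≠ 0 → ∫⁻ u, β u ∂νN ≠ ∞ →
        ∀ S : skewMatrices ((IsCMField.complexConj L : L ≃ₐ[Fp L] L) : L →+* L) ((gramR L e dV hdV dW hdW).map (algebraMap (Fp L) L)),
          (S : Matrix (Fin n) (Fin n) L).det ≠ 0 → ∀ (s : ℂ) (h : HA L e dV hdV dW hdW), (n : ℝ) / 2 < s.re →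
            EcW S s h = (∏ p ∈ P, (s - p)) *
              fourierCoeffDelta L e dV hdV dW hdW νN β (S : Matrix (Fin n) (Fin n) L) (eisensteinFamilyDelta L e dV hdV dW hdW f s) h) ∧
      (∀ z : ℂ, 0 < z.re → ∃ C A r : ℝ, 0 ≤ C ∧ 0 ≤ A ∧ 0 < r ∧ ∀ S (s : ℂ), dist s z < r → ∀ h : HA L e dV hdV dW hdW,
        ‖EcW S s h‖ ≤ C * w S * adelicHeightGL (n + n) L (h : GL (Fin (n + n)) (AdeleRing (𝓞 L) L)) ^ A) := by
  classical
  -- the height on `H(𝔸)`: positive, continuous, hence bounded on compacts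
  haveI : NeZero (n + n) := ⟨by omega⟩
  set height : HA L e dV hdV dW hdW → ℝ := fun h => adelicHeightGL (n + n) L (h : GL (Fin (n + n)) (AdeleRing (𝓞 L) L)) with hheight
  have hpos : ∀ h, 0 < height h := fun h => adelicHeightGL_pos_holds (h : GL (Fin (n + n)) (AdeleRing (𝓞 L) L))
  have hHc : Continuous height := continuous_adelicHeightGL.comp continuous_subtype_val
  have hcpt : ∀ K : Set (HA L e dV hdV dW hdW), IsCompact K → ∃ B : ℝ, ∀ h ∈ K, height h ≤ B := fun K hK => by
    obtain ⟨B, hB⟩ := hK.bddAbove_image hHc.continuousOn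
    exact ⟨B, fun h hh => hB ⟨h, hh, rfl⟩⟩
  -- a Fourier carrier (★ Φ3b Haar on `N_Δ(𝔸)`, ★ (C0) cocompact cover, ★ covering weight of finite non-zero mass), as in the TOP's edition 2
  haveI : LocallyCompactSpace (unipDelta L e dV hdV dW hdW) := locallyCompactSpace_unipDelta L e dV hdV dW hdW
  haveI : Countable (unipDeltaRat L e dV hdV dW hdW) := countable_unipDeltaRat L e dV hdV dW hdW
  obtain ⟨K, hK, hcover⟩ := exists_isCompact_cover_unipDelta L e dV hdV dW hdW hdV0 hdW0
  obtain ⟨β, hβ, -, -, hβtop⟩ :=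
    exists_isCoveringWeight_unipDeltaRat_lintegral_ne_top L e dV hdV dW hdW (Measure.haar : Measure (unipDelta L e dV hdV dW hdW)) hK hcover
  have hν : (Measure.haar : Measure (unipDelta L e dV hdV dW hdW)) ≠ 0 := by
    intro h0
    have h1 := isOpen_univ.measure_ne_zero (Measure.haar : Measure (unipDelta L e dV hdV dW hdW)) Set.univ_nonempty
    rw [h0] at h1
    exact h1 rfl
  have hβ0 : ∫⁻ u, β u ∂(Measure.haar : Measure (unipDelta L e dV hdV dW hdW)) ≠ 0 :=
    lintegral_ne_zero_of_isCoveringWeight _ hν (unipDeltaRat L e dV hdV dW hdW) hβ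
  -- the per-`S` growth letter in the §2 currency (constant `C(z)·w(S)`)
  have hgS : ∀ S, ∀ z : ℂ, 0 < z.re → ∃ C A r : ℝ, 0 ≤ C ∧ 0 ≤ A ∧ 0 < r ∧ ∀ s : ℂ, dist s z < r → ∀ h,
      ‖WT S s h * G S s h‖ ≤ C * height h ^ A := fun S z hz => by
    obtain ⟨C, A, r, hC, hA, hr, hle⟩ := hg z hz
    exact ⟨C * w S, A, r, mul_nonneg hC (hw S), hA, hr, fun s hs h => hle S s hs h⟩
  have hc : (0 : ℝ) ≤ (n : ℝ) / 2 := by positivity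
  -- the packages
  refine ⟨fun S s h => if (S : Matrix (Fin n) (Fin n) L).det = 0 then 0 else (∏ p ∈ P, (s - p)) * (WT S s h * G S s h),
    fun S hS s h => by simp only [hS, ↓reduceIte], fun S h => ?_, fun S s hs => ?_, fun νN _ β' hβ' hβ'0 hβ'top S hS s h hs => ?_, fun z hz => ?_⟩
  · -- (i)
    by_cases hS : (S : Matrix (Fin n) (Fin n) L).det = 0
    · simp only [hS, ↓reduceIte]; exact differentiableOn_const 0
    · simp only [hS, ↓reduceIte]; exact differentiableOn_whittakerPackage (WT S) (G S) (hWTd S) (hGd S) P h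
  · -- (ii)
    by_cases hS : (S : Matrix (Fin n) (Fin n) L).det = 0
    · simp only [hS, ↓reduceIte]; exact continuous_const
    · simp only [hS, ↓reduceIte]
      exact continuous_whittakerPackage height hpos hcpt (WT S) (hWTd S) (G S) (hGd S) (hgS S) hc
        (fun s h => fourierCoeffDelta L e dV hdV dW hdW Measure.haar β (S : Matrix (Fin n) (Fin n) L) (eisensteinFamilyDelta L e dV hdV dW hdW f s) h)
        (fun s hs => hRKc Measure.haar β hβ hβ0 hβtop S hS s hs) (fun s h hs => hRK Measure.haar β hβ hβ0 hβtop S hS s h hs) P hs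
  · -- (iv)
    simp only [hS, ↓reduceIte]
    rw [hRK νN β' hβ' hβ'0 hβ'top S hS s h hs]
  · -- (v), weighted
    obtain ⟨C, A, r, hC, hA, hr, hle⟩ := hg z hz
    obtain ⟨δ, hδ, hd⟩ := Metric.continuousAt_iff.1 (continuous_poleClearing P).continuousAt 1 one_pos
    refine ⟨(‖∏ p ∈ P, (z - p)‖ + 1) * C, A, min r δ, by positivity, hA, lt_min hr hδ, fun S s hs h => ?_⟩
    have hnn : 0 ≤ (‖∏ p ∈ P, (z - p)‖ + 1) * C * w S * height h ^ A := by
      have := hw S; have := (hpos h).le; positivity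
    by_cases hS : (S : Matrix (Fin n) (Fin n) L).det = 0
    · simp only [hS, ↓reduceIte, norm_zero]; exact hnn
    · simp only [hS, ↓reduceIte]
      have ha' : ‖∏ p ∈ P, (s - p)‖ ≤ ‖∏ p ∈ P, (z - p)‖ + 1 := by
        have h1 : dist (∏ p ∈ P, (s - p)) (∏ p ∈ P, (z - p)) < 1 := hd (lt_of_lt_of_le hs (min_le_right _ _))
        rw [dist_eq_norm] at h1
        calc ‖∏ p ∈ P, (s - p)‖ = ‖(∏ p ∈ P, (z - p)) + ((∏ p ∈ P, (s - p)) - ∏ p ∈ P, (z - p))‖ := by rw [add_sub_cancel]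
          _ ≤ ‖∏ p ∈ P, (z - p)‖ + ‖(∏ p ∈ P, (s - p)) - ∏ p ∈ P, (z - p)‖ := norm_add_le _ _
          _ ≤ ‖∏ p ∈ P, (z - p)‖ + 1 := by linarith
      calc ‖(∏ p ∈ P, (s - p)) * (WT S s h * G S s h)‖ = ‖∏ p ∈ P, (s - p)‖ * ‖WT S s h * G S s h‖ := norm_mul _ _
        _ ≤ (‖∏ p ∈ P, (z - p)‖ + 1) * (C * w S * height h ^ A) :=
            mul_le_mul ha' (hle S s (lt_of_lt_of_le hs (min_le_left _ _)) h) (norm_nonneg _) (by positivity)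
        _ = (‖∏ p ∈ P, (z - p)‖ + 1) * C * w S * height h ^ A := by ring

end Instance

end Summit.HodgeConjecture.HodgeConjecture.Cruxes.HLiu418.K2LiuSiegelEisensteinWhittakerTermPackage

end
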